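import Summits.QuantumFields.YangMills.Theorems.UnitScaleTiltHistoryTailLocalProp1
import Summits.QuantumFields.YangMills.Theorems.AlphaInputsT3ACHistories
import Literature.MathematicalPhysics.QuantumFieldTheory.Balaban1983to89.B3Taylor310LocalRemainder
import HarnessLib

/-!
# `UnitScaleTiltHistoryTailLocalProp1Regions` — LOCAL [Balaban1985Averaging] Prop. 1 for `blockAvg ℰp` in the lane's REGION letters:
# `PlaqSmallOn {q : plaqCover q ⊆ Ω_k} ⇒ PlaqSmallOn (plaqsIn (k+1) Ω_{k+1})` as soon as the (39) collar `Rcol k` is at least `6L` fine steps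

Cell `ym3-torus` (rung R3), seat `ym3-torus-p2` gen 12 (helper for stmt-QuantumFields-19936 `HistoryTailL`; OWNER RULING g18-№3 §5, alpha-1's spec 06:07:26Z
«`PlaqSmallOn {p : plaqCover p ⊆ Ω_k} θ U ⇒ PlaqSmallOn (plaqsIn (k+1) Ω_{k+1}) (…) (blockAvg ℰp U)` with the (39) collar»).  The sibling module
`UnitScaleTiltHistoryTailLocalProp1` gives the local Prop. 1 with the hypothesis «small on the blocks at `ℓ^∞`-distance `≤ 1` from the corner»; here
that hypothesis is derived from smallness on the lane's region `Ω_k(h)` (`Carriers.Regions.Omega`, the (38)–(39) regions of a history, collar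
`Rcol k` in scale-`k` lattice steps) for the plaquettes of the NEXT region `Ω_{k+1}(h)` (`B10Eq38TorusDomains.plaqsIn`): a corner `z` of a level-`k`
plaquette `q` whose base block is within `ℓ^∞`-distance `1` of `y = p′₋` is within `ℓ¹`-distance `2·d·L` of the block centre `emb y`, and `emb y`
carries a point of `Ω_{k+1}` (`toFine`), so `Rcol k ≥ 2dL` forces `plaqCover q ⊆ Ω_k` (`Regions.mem_Omega_succ_self`).

* §1 torus bookkeeping: `tdist_le_of_sub_eq_intCast`, `exists_blockOffset`, `tdist_corner_emb_le` (a corner of `q` with `blockOf q₋` near `y` is at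
  `ℓ¹`-distance `≤ d·(2L)` from `emb y`);
* §2 `plaqCover_subset_Omega_of_near` (the region step) and **`blockAvg_plaqSmallOn_plaqsIn_Omega`**: for `0 < γ ≤ 1`, `γ ≤ γw`, `k + 1 ≤ K`,
  `2·3·L ≤ Rcol k`, every history `h` of level `k + 1` of run `K`:
  `PlaqSmallOn {q | plaqCover q ⊆ Ω_k(h.proj)} (θBal (K−k)) U → PlaqSmallOn ↑(plaqsIn (k+1) (Ω_{k+1} h)) (avgWindowFactor L · θBal (K−k)) (blockAvg ℰp U)`.
No `sorry`; nothing of Bałaban's estimates beyond the crude Prop. 1 constants already in the tree.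

References: T. Bałaban, CMP 98 (1985) 17–51 [Balaban1985Averaging] (Prop. 1 (51) p.26); CMP 102 (1985) 255–275 [Balaban1985UV3] ((38)–(40) p.266).
-/

noncomputable section

namespace Summit.QuantumFields.YangMills.Theorems.HistoryTailLocalProp1

open Literature.MathematicalPhysics.QuantumFieldTheory.Balaban1983to89
open Literature.MathematicalPhysics.QuantumFieldTheory.Balaban1983to89.T3ContinuumYM3Torus
open Literature.MathematicalPhysics.QuantumFieldTheory.Balaban1983to89.T3UnitLawDensityEML (ℰp)
open Literature.MathematicalPhysics.QuantumFieldTheory.Balaban1983to89.T3UnitScaleTilt (θBal)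
open Literature.MathematicalPhysics.QuantumFieldTheory.Balaban1983to89.T3AlphaInputsAC
open Literature.MathematicalPhysics.QuantumFieldTheory.Balaban1983to89.B10Eq38TorusDomains (toFine toFine_succ cornerSet plaqsIn mem_plaqsIn_iff)
open Literature.MathematicalPhysics.QuantumFieldTheory.Balaban1985CMP102
open Literature.MathematicalPhysics.QuantumFieldTheory.Balaban1985CMP102.Setting
open Summit.QuantumFields.Balaban3D.Carriers
open Summit.QuantumFields.Balaban3D.Proofs.Primitives

/-! ## §1 Torus bookkeeping: a corner of a near plaquette is `ℓ¹`-close to the block centre -/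

section Geometry

variable {P : Params} {j : ℕ}

/-- The circular distance of a coordinate difference that is the cast of an integer `e` is at most `|e|`. [folklore] -/
private theorem natAbs_valMinAbs_intCast_le {N : ℕ} [NeZero N] (e : ℤ) : (((e : ZMod N)).valMinAbs).natAbs ≤ e.natAbs :=
  ZMod.natAbs_min_of_le_div_two N _ e (ZMod.coe_valMinAbs _) (ZMod.natAbs_valMinAbs_le _)

/-- **`ℓ¹` torus distance from coordinatewise integer offsets**: if `x_κ − y_κ` is the cast of an integer `e_κ` with `|e_κ| ≤ t` for every `κ`,
then `|x − y|₁ ≤ d·t`. [folklore] -/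
theorem tdist_le_of_sub_eq_intCast (x y : Site P j) (e : Fin P.d → ℤ) (t : ℕ)
    (hxy : ∀ κ, x κ - y κ = ((e κ : ℤ) : ZMod (P.sitesPerDir j))) (he : ∀ κ, (e κ).natAbs ≤ t) :
    Site.tdist x y ≤ P.d * t := by
  rw [B3Taylor310LocalRemainder.tdist_eq_sum_natAbs]
  calc ∑ κ : Fin P.d, ((x κ - y κ).valMinAbs).natAbs ≤ ∑ _κ : Fin P.d, t :=
        Finset.sum_le_sum fun κ _ => by rw [hxy κ]; exact (natAbs_valMinAbs_intCast_le _).trans (he κ)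
    _ = P.d * t := by simp

/-- Every fine site is its block's centre displaced by an offset in `[−(L−1)/2, (L−1)/2]` coordinatewise (standing range): `x_κ = (emb (blockOf x))_κ +
(r_κ − (L−1)/2)` with `r_κ ∈ {0, …, L−1}`. [folklore] -/
theorem exists_blockOffset (hj : j + 1 ≤ P.m + P.K) (x : Site P j) :
    ∃ r : Fin P.d → Fin P.L, ∀ κ, x κ = emb (blockOf x) κ + ((((r κ : ℕ) : ℤ) - (((P.L - 1) / 2 : ℕ) : ℤ) : ℤ) : ZMod (P.sitesPerDir j)) := by
  set H : ℕ := (P.L - 1) / 2 with hH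
  refine ⟨Site.blockEquiv hj (blockOf x) ⟨x, rfl⟩, fun κ => ?_⟩
  have hx : Site.blockSite (blockOf x) (Site.blockEquiv hj (blockOf x) ⟨x, rfl⟩) = x :=
    congrArg Subtype.val ((Site.blockEquiv hj (blockOf x)).symm_apply_apply ⟨x, rfl⟩)
  have hval : (x κ).val = ((blockOf x) κ).val * P.L + (Site.blockEquiv hj (blockOf x) ⟨x, rfl⟩ κ : ℕ) := by
    rw [← Site.val_blockSite hj (blockOf x) _ κ, hx]
  have hemb : ((emb (blockOf x)) κ).val = ((blockOf x) κ).val * P.L + H := by rw [hH]; exact Site.val_emb hj (blockOf x) κ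
  have h1 : x κ = (((x κ).val : ℕ) : ZMod (P.sitesPerDir j)) := (ZMod.natCast_zmod_val _).symm
  have h2 : emb (blockOf x) κ = (((emb (blockOf x) κ).val : ℕ) : ZMod (P.sitesPerDir j)) := (ZMod.natCast_zmod_val _).symm
  rw [h1, h2, hval, hemb]
  push_cast
  ring

/-- The difference of the centres of two coarse sites that are `ℓ^∞`-neighbours coordinatewise is `0` or `±L` coordinatewise. [folklore] -/
private theorem emb_sub_emb_of_near (y b : Site P (j + 1)) (κ : Fin P.d) (h : b κ = y κ ∨ b κ = y κ + 1 ∨ b κ = y κ - 1) :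
    ∃ s : ℤ, s.natAbs ≤ P.L ∧ emb b κ - emb y κ = ((s : ℤ) : ZMod (P.sitesPerDir j)) := by
  rw [Site.emb_apply_eq, Site.emb_apply_eq, add_sub_add_right_eq_sub, ← map_sub]
  rcases h with h | h | h
  · exact ⟨0, by simp, by rw [h, sub_self, map_zero]; simp⟩
  · exact ⟨P.L, by simp, by rw [h, add_sub_cancel_left, Site.scaleCoord_one]; simp⟩
  · refine ⟨-(P.L : ℤ), by simp, ?_⟩
    rw [h, show y κ - 1 - y κ = -1 by ring, map_neg, Site.scaleCoord_one]
    simp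

/-- **A CORNER OF A NEAR PLAQUETTE IS `ℓ¹`-CLOSE TO THE BLOCK CENTRE**: if the base block of the level-`j` plaquette `q` is within `ℓ^∞`-distance
`1` of the coarse site `y` (coordinatewise `y_κ`, `y_κ ± 1`), then every corner of `q` is within `ℓ¹`-distance `d·(2L)` of `emb y` (standing range).
[folklore] -/
theorem tdist_corner_emb_le (hj : j + 1 ≤ P.m + P.K) (q : Plaq P j) (y : Site P (j + 1))
    (hnear : ∀ κ, blockOf q.src κ = y κ ∨ blockOf q.src κ = y κ + 1 ∨ blockOf q.src κ = y κ - 1) (z : Site P j)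
    (hz : z = q.src ∨ z = q.src.shift q.μ ∨ z = q.src.shift q.ν ∨ z = (q.src.shift q.μ).shift q.ν) :
    Site.tdist z (emb y) ≤ P.d * (2 * P.L) := by
  have hL3 : 3 ≤ P.L := by
    have h1 := P.hL.2
    obtain ⟨t, ht⟩ := P.hL.1
    omega
  -- the corner as the base plus at most one step in each of two coordinates
  obtain ⟨c, hc2, hzc⟩ : ∃ c : Fin P.d → ℕ, (∀ κ, c κ ≤ 2) ∧ ∀ κ, z κ = q.src κ + ((c κ : ℕ) : ZMod (P.sitesPerDir j)) := by
    rcases hz with rfl | rfl | rfl | rfl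
    · exact ⟨fun _ => 0, fun _ => by norm_num, fun κ => by simp⟩
    · refine ⟨fun κ => if κ = q.μ then 1 else 0, fun κ => ?_, fun κ => ?_⟩
      · dsimp only; split_ifs <;> omega
      · dsimp only
        rw [Site.shift_apply]
        by_cases h : κ = q.μ
        · rw [if_pos h, if_pos h, h]; push_cast; ring
        · rw [if_neg h, if_neg h]; push_cast; ring
    · refine ⟨fun κ => if κ = q.ν then 1 else 0, fun κ => ?_, fun κ => ?_⟩
      · dsimp only; split_ifs <;> omega
      · dsimp only
        rw [Site.shift_apply]
        by_cases h : κ = q.ν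
        · rw [if_pos h, if_pos h, h]; push_cast; ring
        · rw [if_neg h, if_neg h]; push_cast; ring
    · refine ⟨fun κ => (if κ = q.μ then 1 else 0) + (if κ = q.ν then 1 else 0), fun κ => ?_, fun κ => ?_⟩
      · dsimp only; split_ifs <;> omega
      · dsimp only
        rw [Site.shift_apply]
        by_cases hν : κ = q.ν
        · rw [if_pos hν, if_pos hν, Site.shift_apply]
          by_cases hμ : q.ν = q.μ
          · rw [if_pos hμ, if_pos (hν.trans hμ), hν, hμ]; push_cast; ring
          · rw [if_neg hμ, if_neg (fun h => hμ (hν.symm.trans h)), hν]; push_cast; ring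
        · rw [if_neg hν, if_neg hν, Site.shift_apply]
          by_cases hμ : κ = q.μ
          · rw [if_pos hμ, if_pos hμ, hμ]; push_cast; ring
          · rw [if_neg hμ, if_neg hμ]; push_cast; ring
  obtain ⟨r, hr⟩ := exists_blockOffset hj q.src
  -- coordinatewise integer offsets
  have key : ∀ κ, ∃ e : ℤ, e.natAbs ≤ 2 * P.L ∧ z κ - emb y κ = ((e : ℤ) : ZMod (P.sitesPerDir j)) := by
    intro κ
    obtain ⟨s, hs, hsb⟩ := emb_sub_emb_of_near y (blockOf q.src) κ (hnear κ)
    refine ⟨s + (((r κ : ℕ) : ℤ) - (((P.L - 1) / 2 : ℕ) : ℤ)) + (c κ : ℕ), ?_, ?_⟩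
    · have h1 := (r κ).isLt
      have h2 := hc2 κ
      have h3 : 2 * ((P.L - 1) / 2) + 1 = P.L := AveragingRT.two_mul_half_add_one P
      omega
    · rw [hzc κ, hr κ, show emb (blockOf q.src) κ + ((((r κ : ℕ) : ℤ) - (((P.L - 1) / 2 : ℕ) : ℤ) : ℤ) : ZMod (P.sitesPerDir j)) +
          ((c κ : ℕ) : ZMod (P.sitesPerDir j)) - emb y κ =
        (emb (blockOf q.src) κ - emb y κ) + ((((r κ : ℕ) : ℤ) - (((P.L - 1) / 2 : ℕ) : ℤ) : ℤ) : ZMod (P.sitesPerDir j)) +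
          ((c κ : ℕ) : ZMod (P.sitesPerDir j)) by ring, hsb]
      push_cast
      ring
  choose e he using key
  exact tdist_le_of_sub_eq_intCast z (emb y) e (2 * P.L) (fun κ => (he κ).2) (fun κ => (he κ).1)

end Geometry

/-! ## §2 The region step: `plaqCover q ⊆ Ω_k` for near plaquettes of `plaqsIn (k+1) Ω_{k+1}`, and the lane-letter local Prop. 1 -/

section Regions

variable {P : Params} (M₁ : ℕ) (Rcol : ℕ → ℕ)

/-- **THE REGION STEP**: if `p′` is a plaquette of `T^{(k+1)}` all of whose corners lie in `Ω_{k+1}(h)` (`plaqsIn`), the collar satisfies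
`d·(2L) ≤ Rcol k`, and `q` is a plaquette of `T^{(k)}` whose base block is within `ℓ^∞`-distance `1` of `p′₋`, then `plaqCover q ⊆ Ω_k(h.proj)`:
the fine point `toFine (k+1) p′₋ ∈ Ω_{k+1}` sits over `emb p′₋`, every fine site covered by `q` coarsens to a corner of `q`, hence to within
`ℓ¹`-distance `d·2L ≤ Rcol k` of it at scale `k` — and `Ω_{k+1}` keeps distance `> Rcol k` from `Ω_kᶜ` (`Regions.mem_Omega_succ_self`).
[cite: Balaban1985UV3, (38)-(39) p.266] -/
theorem plaqCover_subset_Omega_of_near {k : ℕ} (hk : k + 1 ≤ P.m + P.K) (hR : P.d * (2 * P.L) ≤ Rcol k) (h : Hist P (k + 1))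
    (p' : Plaq P (k + 1)) (hp' : p' ∈ plaqsIn (k + 1) (Omega M₁ Rcol (k + 1) h (k + 1))) (q : Plaq P k)
    (hnear : ∀ κ, blockOf q.src κ = p'.src κ ∨ blockOf q.src κ = p'.src κ + 1 ∨ blockOf q.src κ = p'.src κ - 1) :
    plaqCover q ⊆ Omega M₁ Rcol k h.proj k := by
  intro x hx
  by_contra hxΩ
  have hy0 : toFine (k + 1) p'.src ∈ Omega M₁ Rcol (k + 1) h (k + 1) :=
    (mem_plaqsIn_iff.mp hp') (by simp [cornerSet])
  have hfar := (mem_Omega_succ_self M₁ Rcol h _).mp hy0 (toFine (k + 1) p'.src) rfl x (Or.inr hxΩ)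
  -- `sdist k x (toFine (k+1) p′₋) = tdist (coarsen k x) (emb p′₋) ≤ d·2L`
  have hco : coarsen k (toFine (k + 1) p'.src) = emb p'.src := by
    rw [toFine_succ, coarsen_toFine k (by omega) (emb p'.src)]
  have hz : coarsen k x = q.src ∨ coarsen k x = q.src.shift q.μ ∨ coarsen k x = q.src.shift q.ν ∨
      coarsen k x = (q.src.shift q.μ).shift q.ν := hx
  have hle := tdist_corner_emb_le hk q p'.src hnear (coarsen k x) hz
  unfold sdist at hfar
  rw [hco] at hfar
  omega

variable {F : T3Family}

/-- **LOCAL [Balaban1985Averaging] PROP. 1 IN THE LANE'S REGION LETTERS** (alpha-1's spec shape): for `0 < γ ≤ 1`, `γ ≤ γw(L, b₀, p₀)`, `k + 1 ≤ m + K`,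
a collar `3·(2L) ≤ Rcol k` and any history `h` of level `k + 1` of run `K`: if every level-`k` plaquette `q` with `plaqCover q ⊆ Ω_k(h.proj)` is
`θBal(K − k)`-small, then `blockAvg ℰp U` is `avgWindowFactor(L)·θBal(K − k)`-small on every plaquette of `plaqsIn (k+1) (Ω_{k+1}(h))` — the window
`χ_{k+1}` of [Balaban1985UV3] (40) on the next region from small fields on the current one. [cite: Balaban1985Averaging, Prop. 1 (51) p.26; Balaban1985UV3, (38)-(40) p.266] -/
theorem blockAvg_plaqSmallOn_plaqsIn_Omega (𝔠 : AlphaConsts F.L (suGroupModel 2).N) {γ : ℝ} (hγ : 0 < γ) (hγ1 : γ ≤ 1)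
    (hγw : γ ≤ AlphaInputsT3AC.γwOf F.L 𝔠.b₀ 𝔠.p₀) (K k : ℕ) (hk : k + 1 ≤ F.m + K) (hR : 3 * (2 * F.L) ≤ Rcol k)
    (h : Hist (F.P K) (k + 1)) (U : GaugeField (F.P K) k (Matrix.specialUnitaryGroup (Fin 2) ℂ))
    (hU : PlaqSmallOn {q : Plaq (F.P K) k | plaqCover q ⊆ Omega M₁ Rcol k h.proj k} (θBal F.L γ 𝔠.b₀ 𝔠.p₀ (K - k)) U) :
    PlaqSmallOn (↑(plaqsIn (k + 1) (Omega M₁ Rcol (k + 1) h (k + 1))) : Set (Plaq (F.P K) (k + 1)))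
      (avgWindowFactor F.L * θBal F.L γ 𝔠.b₀ 𝔠.p₀ (K - k))
      ((BlockAveraging.blockAvg (P := F.P K) (j := k) ℰp).avg U) := by
  refine blockAvg_plaqSmallOn_of_near F 𝔠 hγ hγ1 hγw K k hk U _ fun q hq => hU q ?_
  obtain ⟨p', hp', hnear⟩ := hq
  exact plaqCover_subset_Omega_of_near M₁ Rcol (P := F.P K) hk hR h p' (Finset.mem_coe.mp hp') q hnear

end Regions

end Summit.QuantumFields.YangMills.Theorems.HistoryTailLocalProp1

end
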